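import Literature.MathematicalPhysics.QuantumManyBody.NeumannCosineParseval
import Literature.MathematicalPhysics.QuantumManyBody.NeumannBoxEigenbasis
import HarnessLib

/-!
# Parseval and the Neumann form for the product cosine modes of a cube, and of the box `(0,ℓ)³`

Topic `Literature/MathematicalPhysics/QuantumManyBody`, grouping namespace `NeumannBox` (provefact
`Literature.MathematicalPhysics.QuantumManyBody.BoseGas.Junge2026_neumannBox_pinnedLowerBound`;
third brick of the operator layer of [FournaisEtAl2024, §2], after `NeumannBoxEigenbasis.lean`
(the modes `e_n = c_n ℓ^{-1/2}cos(nπx/ℓ)`, `u_k = ∏ᵢ e_{kᵢ}(xᵢ)` of [FournaisEtAl2024, (2.20)] and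
their orthonormality) and `NeumannCosineParseval.lean` (completeness of `(e_n)` in `L²(0,ℓ)` and
the diagonalisation `∫₀^ℓ|f'|² = ∑ₙ (nπ/ℓ)²|⟨e_n,f⟩|²` of the one-dimensional Neumann form)).
Everything in [FournaisEtAl2024, §2.3–§2.6] beyond the a priori bounds — the momentum cut-offs
`Q^L = 1_{𝒫_L}(√-Δ)`, `Q^H` (2.10), the kinetic-energy gaps of Thm. 2.3, the symmetrisation
Lemma 2.5, the second quantisation Lemma 2.8 — is written in "the normalized eigenbasis of the
Neumann Laplacian on `Λ = [0,ℓ]³`", i.e. rests on two facts about the THREE-dimensional modes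
`u_k`: they are an orthonormal BASIS of `L²(Λ)`, and `-Δ_Neumann = ∑_k (π/ℓ)²|k|² |u_k⟩⟨u_k|` in
form sense on all of `H¹(Λ)` (no boundary condition). Both are proved here, for continuous
(resp. `C¹`) functions, on the cube `[0,ℓ]^d ⊂ ℝ^d` in every dimension `d` and then on the
one-particle box `Λ_ℓ = box ℓ = (0,ℓ)³ ⊂ Space` of the topic (the carrier of `boxN`,
`NeumannTrialState`, `neumannEnergy`, `kineticDensity`):

* `tsum_enorm_sq_coef` / `hasSum_sq_norm_coef` — **Parseval on the cube**: for continuous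
  `g : ℝ^d → ℂ`, `∑_{k ∈ ℕ₀^d} |∫_{[0,ℓ]^d} u_k g|² = ∫_{[0,ℓ]^d} |g|²` (`ℝ≥0∞` and real forms);
* `tsum_sum_waveNumber_sq_mul_enorm_sq_coef` / `hasSum_sum_waveNumber_sq_mul_sq_norm_coef` —
  **the Neumann form is diagonal**: for `g ∈ C¹`,
  `∑_k (∑ᵢ (kᵢπ/ℓ)²) |∫ u_k g|² = ∫_{[0,ℓ]^d} ∑ᵢ |∂ᵢ g|²`, and coordinate-wise
  (`tsum_waveNumber_sq_mul_enorm_sq_coef`);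
* `lintegral_enorm_sq_le_of_contDiff` — **the sharp Neumann gap `π²/ℓ²` of the cube**:
  `∫|g|² ≤ |⟨u_0, g⟩|² + (ℓ/π)² ∫|∇g|²`, i.e. `‖Qg‖² ≤ (ℓ²/π²)⟨g,-Δ_N g⟩` for the projection `Q`
  off the constants [LSSY2005, Ch. 2, after (2.50): `E₁⁽⁰⁾ = π²/ℓ²`];
* on `Space = ℝ³`: `tsum_enorm_sq_setIntegral_box_mode_mul`,
  `hasSum_sq_norm_setIntegral_box_mode_mul` (Parseval for `mode ℓ k` on `box ℓ`),
  `tsum_sum_waveNumber_sq_mul_enorm_sq_setIntegral_box_mode_mul` (the kinetic energy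
  `∫_Λ ∑ᵢ |∂ᵢf|²`, partial derivatives along `EuclideanSpace.single i 1` exactly as in
  `kineticDensity`, equals `∑_k (π/ℓ)²|k|² |⟨u_k,f⟩|²`), and `setLIntegral_box_enorm_sq_le`
  (the gap on the box), via the measure-preserving identification `ℝ³ ≃ (Fin 3 → ℝ)`
  (`setIntegral_box_eq_integral_Icc`, `setLIntegral_box_eq_lintegral_Icc`,
  `fderiv_comp_toLp_single`).

Method (all dimensions at once, by induction on `d`): the **slicing engine**
`tsum_mul_enorm_sq_coef_eq_of_fibre` — slice `[0,ℓ]^{d+1} ≅ [0,ℓ] × [0,ℓ]^d` at a coordinate `i`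
(Mathlib's measure-preserving `piFinSuccAbove`), apply a one-dimensional identity on each fibre
(cosine Parseval, or the form identity for `∂ᵢ`), Tonelli, the `d`-dimensional Parseval for the
(continuous) partial coefficients `y' ↦ ∫₀^ℓ e_n(t) g(…t…)dt`, and Fubini for the coefficients
(`integral_Icc_prodMode_insertNth_mul`). All sums are handled in `ℝ≥0∞`, where Tonelli and
re-indexing are unconditional; the real `HasSum` forms follow. No definitions.

## References

* [FournaisEtAl2024] S. Fournais, L. Junge, T. Girardot, L. Morin, M. Olivieri, A. Triay, *The free
  energy of dilute Bose gases at low temperatures interacting via strong potentials*,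
  arXiv:2408.14222, Ann. Henri Poincaré (2026): (2.10), (2.20)–(2.21), §2.3, Lemma 2.5, Lemma 2.8.
* [LSSY2005] E. H. Lieb, R. Seiringer, J. P. Solovej, J. Yngvason, *The Mathematics of the Bose Gas
  and its Condensation*, Birkhäuser 2005: Ch. 2, after (2.50).
-/

noncomputable section

open Real intervalIntegral MeasureTheory Set Filter Topology Complex
open scoped ENNReal NNReal

namespace Literature.MathematicalPhysics.QuantumManyBody.NeumannBox

/-! ### One-dimensional identities in `ℝ≥0∞` form, with the normalised modes `e_n = cosMode ℓ n` -/

/-- `∫₀^ℓ e_n f = (c_n/√ℓ) ∫₀^ℓ cos(nπt/ℓ) f`. [folklore] -/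
theorem integral_cosMode_mul_eq {ℓ : ℝ} (n : ℕ) (f : ℝ → ℂ) :
    ∫ t in (0 : ℝ)..ℓ, (cosMode ℓ n t : ℂ) * f t =
      ((cosCoeff n / Real.sqrt ℓ : ℝ) : ℂ) *
        ∫ t in (0 : ℝ)..ℓ, (Real.cos (n * π / ℓ * t) : ℂ) * f t := by
  rw [← intervalIntegral.integral_const_mul]
  congr 1; funext t
  simp only [cosMode, waveNumber]; push_cast; ring

/-- `‖∫₀^ℓ e_n f‖² = (c_n²/ℓ)‖∫₀^ℓ cos(nπt/ℓ) f‖²` (`ℓ > 0`). [folklore] -/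
theorem norm_sq_integral_cosMode_mul {ℓ : ℝ} (hℓ : 0 < ℓ) (n : ℕ) (f : ℝ → ℂ) :
    ‖∫ t in (0 : ℝ)..ℓ, (cosMode ℓ n t : ℂ) * f t‖ ^ 2 =
      (if n = 0 then 1 else 2) / ℓ * ‖∫ t in (0 : ℝ)..ℓ, (Real.cos (n * π / ℓ * t) : ℂ) * f t‖ ^ 2 := by
  rw [integral_cosMode_mul_eq, norm_mul, mul_pow, Complex.norm_real, Real.norm_eq_abs, sq_abs,
    div_pow, Real.sq_sqrt hℓ.le, cosCoeff_sq]

/-- `ENNReal.ofReal (∫₀^ℓ ‖f‖²) = ∫⁻_{(0,ℓ]} ‖f‖ₑ²` for continuous `f` (`ℓ ≥ 0`). [folklore] -/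
theorem ofReal_intervalIntegral_norm_sq {ℓ : ℝ} (hℓ : 0 ≤ ℓ) {f : ℝ → ℂ} (hf : Continuous f) :
    ENNReal.ofReal (∫ t in (0 : ℝ)..ℓ, ‖f t‖ ^ 2) = ∫⁻ t in Ioc 0 ℓ, ‖f t‖ₑ ^ 2 := by
  rw [intervalIntegral.integral_of_le hℓ,
    ofReal_integral_eq_lintegral_ofReal (Continuous.integrableOn_Ioc (by fun_prop))
      (ae_of_all _ fun t => by positivity)]
  simp_rw [ENNReal.ofReal_pow (norm_nonneg _), ofReal_norm]

/-- A real `HasSum` with non-negative terms, in `ℝ≥0∞`. [folklore] -/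
theorem tsum_ofReal_eq_of_hasSum {a : ℕ → ℝ} {S : ℝ} (ha : ∀ n, 0 ≤ a n) (h : HasSum a S) :
    ∑' n, ENNReal.ofReal (a n) = ENNReal.ofReal S := by
  rw [← ENNReal.ofReal_tsum_of_nonneg ha h.summable, h.tsum_eq]

/-- **Cosine Parseval in the normalised modes, `ℝ≥0∞` form**: for continuous `f : ℝ → ℂ` and
`ℓ > 0`, `∑ₙ ‖∫₀^ℓ e_n f‖² = ∫₀^ℓ ‖f‖²`. [folklore] -/
theorem tsum_enorm_sq_integral_cosMode_mul {ℓ : ℝ} (hℓ : 0 < ℓ) {f : ℝ → ℂ} (hf : Continuous f) :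
    ∑' n : ℕ, ‖∫ t in (0 : ℝ)..ℓ, (cosMode ℓ n t : ℂ) * f t‖ₑ ^ 2 = ∫⁻ t in Ioc 0 ℓ, ‖f t‖ₑ ^ 2 := by
  rw [← ofReal_intervalIntegral_norm_sq hℓ.le hf,
    ← tsum_ofReal_eq_of_hasSum (fun n => by positivity) (hasSum_sq_integral_cos_mul hℓ hf)]
  congr 1; funext n
  rw [← ofReal_norm, ← ENNReal.ofReal_pow (norm_nonneg _), norm_sq_integral_cosMode_mul hℓ]

/-- **The Neumann form in the normalised modes, `ℝ≥0∞` form**: for `f ∈ C¹[0,ℓ]`,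
`∑ₙ (nπ/ℓ)² ‖∫₀^ℓ e_n f‖² = ∫₀^ℓ ‖f'‖²`. [cite: LSSY2005, Ch. 2, after (2.50)] -/
theorem tsum_waveNumber_sq_mul_enorm_sq_integral_cosMode_mul {ℓ : ℝ} (hℓ : 0 < ℓ) {f f' : ℝ → ℂ}
    (hf : ∀ x ∈ uIcc (0 : ℝ) ℓ, HasDerivAt f (f' x) x) (hf' : Continuous f') :
    ∑' n : ℕ, ENNReal.ofReal (waveNumber ℓ n ^ 2) *
        ‖∫ t in (0 : ℝ)..ℓ, (cosMode ℓ n t : ℂ) * f t‖ₑ ^ 2 = ∫⁻ t in Ioc 0 ℓ, ‖f' t‖ₑ ^ 2 := by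
  rw [← ofReal_intervalIntegral_norm_sq hℓ.le hf',
    ← tsum_ofReal_eq_of_hasSum (fun n => by positivity) (hasSum_sq_norm_deriv hℓ hf hf')]
  congr 1; funext n
  rw [← ofReal_norm, ← ENNReal.ofReal_pow (norm_nonneg _), ← ENNReal.ofReal_mul (sq_nonneg _),
    norm_sq_integral_cosMode_mul hℓ, waveNumber]
  congr 1
  split_ifs with hn
  · subst hn; simp
  · ring

/-! ### The cube `[0,ℓ]^d` sliced at a coordinate -/

variable {d : ℕ} {ℓ : ℝ}

/-- Slicing the cube at the coordinate `i`: `[0,ℓ]^{d+1} = e⁻¹([0,ℓ] × [0,ℓ]^d)` for Mathlib's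
`e = piFinSuccAbove _ i : ℝ^{d+1} ≃ᵐ ℝ × ℝ^d`, `y ↦ (yᵢ, (y_{σᵢ(j)})ⱼ)`. [folklore] -/
theorem Icc_eq_preimage_piFinSuccAbove (i : Fin (d + 1)) (ℓ : ℝ) :
    (Icc (0 : Fin (d + 1) → ℝ) fun _ => ℓ) =
      MeasurableEquiv.piFinSuccAbove (fun _ => ℝ) i ⁻¹'
        (Icc (0 : ℝ) ℓ ×ˢ Icc (0 : Fin d → ℝ) fun _ => ℓ) := by
  ext y
  simp only [Set.mem_Icc, Pi.le_def, Pi.zero_apply, Set.mem_preimage,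
    MeasurableEquiv.piFinSuccAbove_apply, Fin.insertNthEquiv_symm_apply, Set.mem_prod,
    Fin.removeNth_apply]
  rw [Fin.forall_iff_succAbove i, Fin.forall_iff_succAbove (P := fun j => y j ≤ ℓ) i]
  tauto

/-- The inverse of the slicing map inserts the distinguished coordinate. [folklore] -/
theorem piFinSuccAbove_symm_apply' (i : Fin (d + 1)) (t : ℝ) (y' : Fin d → ℝ) :
    (MeasurableEquiv.piFinSuccAbove (fun _ => ℝ) i).symm (t, y') = i.insertNth t y' := rfl

/-- The product mode with multi-index `insertNth i n k'` splits off its `i`-th factor. [folklore] -/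
theorem prod_cosMode_insertNth (i : Fin (d + 1)) (n : ℕ) (k' : Fin d → ℕ) (y : Fin (d + 1) → ℝ) :
    (∏ j, cosMode ℓ ((i.insertNth n k' : Fin (d + 1) → ℕ) j) (y j)) =
      cosMode ℓ n (y i) * ∏ j, cosMode ℓ (k' j) (y (i.succAbove j)) := by
  rw [Fin.prod_univ_succAbove _ i]
  simp only [Fin.insertNth_apply_same, Fin.insertNth_apply_succAbove]

/-- **The partial coefficient is continuous**: for continuous `g` on `ℝ^{d+1}`,
`y' ↦ ∫₀^ℓ e_n(t) g(y' with t inserted at i) dt` is continuous on `ℝ^d`. [folklore] -/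
theorem continuous_partialCoeff (i : Fin (d + 1)) {g : (Fin (d + 1) → ℝ) → ℂ}
    (hg : Continuous g) (n : ℕ) :
    Continuous fun y' : Fin d → ℝ =>
      ∫ t in (0 : ℝ)..ℓ, (cosMode ℓ n t : ℂ) * g (i.insertNth t y') := by
  have : Continuous (Function.uncurry fun (y' : Fin d → ℝ) (t : ℝ) =>
      (cosMode ℓ n t : ℂ) * g (i.insertNth t y')) := by
    apply Continuous.mul
    · exact continuous_ofReal.comp ((contDiff_cosMode ℓ n (k := 0)).continuous.comp continuous_snd)
    · exact hg.comp (Continuous.finInsertNth i continuous_snd continuous_fst)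
  exact intervalIntegral.continuous_parametric_intervalIntegral_of_continuous' this 0 ℓ

/-- **Fubini for the coefficients**: the coefficient of `g` on `[0,ℓ]^{d+1}` against the product
mode `u_{insertNth i n k'}` is the coefficient, on `[0,ℓ]^d` against `u_{k'}`, of the partial
coefficient `y' ↦ ∫₀^ℓ e_n(t) g(…t…) dt`. [folklore] -/
theorem integral_Icc_prodMode_insertNth_mul (hℓ : 0 < ℓ) (i : Fin (d + 1))
    {g : (Fin (d + 1) → ℝ) → ℂ} (hg : Continuous g) (n : ℕ) (k' : Fin d → ℕ) :
    ∫ y in Icc (0 : Fin (d + 1) → ℝ) (fun _ => ℓ),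
        ((∏ j, cosMode ℓ ((i.insertNth n k' : Fin (d + 1) → ℕ) j) (y j) : ℝ) : ℂ) * g y =
      ∫ y' in Icc (0 : Fin d → ℝ) (fun _ => ℓ), ((∏ j, cosMode ℓ (k' j) (y' j) : ℝ) : ℂ) *
        ∫ t in (0 : ℝ)..ℓ, (cosMode ℓ n t : ℂ) * g (i.insertNth t y') := by
  set e := MeasurableEquiv.piFinSuccAbove (fun _ : Fin (d + 1) => ℝ) i with he
  have hmp : MeasurePreserving e volume (volume.prod volume) :=
    volume_preserving_piFinSuccAbove _ i
  set F : ℝ × (Fin d → ℝ) → ℂ := fun z =>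
    ((cosMode ℓ n z.1 * ∏ j, cosMode ℓ (k' j) (z.2 j) : ℝ) : ℂ) * g (i.insertNth z.1 z.2) with hF
  have hFc : Continuous F := by
    apply Continuous.mul
    · refine continuous_ofReal.comp ?_
      refine ((contDiff_cosMode ℓ n (k := 0)).continuous.comp continuous_fst).mul ?_
      exact continuous_finsetProd _ fun j _ =>
        (contDiff_cosMode ℓ (k' j) (k := 0)).continuous.comp
          ((continuous_apply j).comp continuous_snd)
    · exact hg.comp (Continuous.finInsertNth i continuous_fst continuous_snd)
  have hintegrand : ∀ y : Fin (d + 1) → ℝ,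
      ((∏ j, cosMode ℓ ((i.insertNth n k' : Fin (d + 1) → ℕ) j) (y j) : ℝ) : ℂ) * g y =
        F (e y) := by
    intro y
    simp only [hF, he, MeasurableEquiv.piFinSuccAbove_apply, Fin.insertNthEquiv_symm_apply,
      Fin.insertNth_self_removeNth, Fin.removeNth_apply, prod_cosMode_insertNth]
  simp_rw [hintegrand]
  rw [Icc_eq_preimage_piFinSuccAbove i ℓ, hmp.setIntegral_preimage_emb e.measurableEmbedding,
    ← Measure.prod_restrict]
  have hint : Integrable F ((volume.restrict (Icc (0 : ℝ) ℓ)).prod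
      (volume.restrict (Icc (0 : Fin d → ℝ) fun _ => ℓ))) := by
    rw [Measure.prod_restrict]
    exact (hFc.continuousOn.integrableOn_compact (isCompact_Icc.prod isCompact_Icc))
  rw [integral_prod_symm F hint]
  refine setIntegral_congr_fun measurableSet_Icc fun y' _ => ?_
  have h1 : ∀ t : ℝ, F (t, y') =
      ((∏ j, cosMode ℓ (k' j) (y' j) : ℝ) : ℂ) *
        ((cosMode ℓ n t : ℂ) * g (i.insertNth t y')) := by
    intro t; simp only [hF]; push_cast; ring
  simp_rw [h1]
  rw [MeasureTheory.integral_const_mul, integral_Icc_eq_integral_Ioc,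
    ← intervalIntegral.integral_of_le hℓ.le]

/-- **The slicing engine.** Suppose Parseval holds for the product modes on `[0,ℓ]^d`
(hypothesis `hA`, for all continuous functions). Let `g` be continuous on `ℝ^{d+1}`, `i` a
coordinate, and suppose on every fibre in the direction `i` a one-dimensional identity
`∑ₙ wₙ ‖∫₀^ℓ e_n(t) g(…t…) dt‖² = ∫₀^ℓ h(…t…) dt` holds (e.g. the cosine Parseval with `w = 1`,
`h = |g|²`, or the form identity with `wₙ = (nπ/ℓ)²`, `h = |∂ᵢg|²`). Then
`∑_k w_{kᵢ} ‖⟨u_k, g⟩‖² = ∫_{[0,ℓ]^{d+1}} h` — Tonelli over the slicing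
`[0,ℓ]^{d+1} ≅ [0,ℓ] × [0,ℓ]^d`, the `d`-dimensional Parseval for the (continuous) partial
coefficients, and Fubini for the coefficients. [folklore] -/
theorem tsum_mul_enorm_sq_coef_eq_of_fibre (hℓ : 0 < ℓ)
    (hA : ∀ {g : (Fin d → ℝ) → ℂ}, Continuous g →
      ∑' k : Fin d → ℕ, ‖∫ y in Icc (0 : Fin d → ℝ) (fun _ => ℓ),
          ((∏ j, cosMode ℓ (k j) (y j) : ℝ) : ℂ) * g y‖ₑ ^ 2 =
        ∫⁻ y in Icc (0 : Fin d → ℝ) (fun _ => ℓ), ‖g y‖ₑ ^ 2)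
    (i : Fin (d + 1)) {g : (Fin (d + 1) → ℝ) → ℂ} (hg : Continuous g) (w : ℕ → ℝ≥0∞)
    {h : (Fin (d + 1) → ℝ) → ℝ≥0∞} (hh : Measurable h)
    (hfib : ∀ y' : Fin d → ℝ,
      ∑' n : ℕ, w n * ‖∫ t in (0 : ℝ)..ℓ, (cosMode ℓ n t : ℂ) * g (i.insertNth t y')‖ₑ ^ 2 =
        ∫⁻ t in Ioc 0 ℓ, h (i.insertNth t y')) :
    ∑' k : Fin (d + 1) → ℕ, w (k i) * ‖∫ y in Icc (0 : Fin (d + 1) → ℝ) (fun _ => ℓ),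
        ((∏ j, cosMode ℓ (k j) (y j) : ℝ) : ℂ) * g y‖ₑ ^ 2 =
      ∫⁻ y in Icc (0 : Fin (d + 1) → ℝ) (fun _ => ℓ), h y := by
  set e := MeasurableEquiv.piFinSuccAbove (fun _ : Fin (d + 1) => ℝ) i with he
  have hmp : MeasurePreserving e volume (volume.prod volume) :=
    volume_preserving_piFinSuccAbove _ i
  set G : ℕ → (Fin d → ℝ) → ℂ := fun n y' =>
    ∫ t in (0 : ℝ)..ℓ, (cosMode ℓ n t : ℂ) * g (i.insertNth t y') with hG
  have hGc : ∀ n, Continuous (G n) := fun n => continuous_partialCoeff i hg n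
  -- the right-hand side, sliced
  have hR : ∫⁻ y in Icc (0 : Fin (d + 1) → ℝ) (fun _ => ℓ), h y =
      ∫⁻ y' in Icc (0 : Fin d → ℝ) (fun _ => ℓ), ∫⁻ t in Ioc 0 ℓ, h (i.insertNth t y') := by
    set H : ℝ × (Fin d → ℝ) → ℝ≥0∞ := fun z => h (e.symm z) with hH
    have h1 : ∫⁻ y in Icc (0 : Fin (d + 1) → ℝ) (fun _ => ℓ), h y =
        ∫⁻ y in e ⁻¹' (Icc (0 : ℝ) ℓ ×ˢ Icc (0 : Fin d → ℝ) fun _ => ℓ), H (e y) := by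
      rw [← Icc_eq_preimage_piFinSuccAbove i ℓ]
      simp only [hH, MeasurableEquiv.symm_apply_apply]
    rw [h1, hmp.setLIntegral_comp_preimage_emb e.measurableEmbedding H, ← Measure.prod_restrict,
      lintegral_prod_symm H (show Measurable H from hh.comp e.symm.measurable).aemeasurable]
    refine setLIntegral_congr_fun measurableSet_Icc fun y' _ => ?_
    rw [Measure.restrict_congr_set Ioc_ae_eq_Icc]
    rfl
  -- Tonelli for the sum over `n`, then the `d`-dimensional Parseval for each partial coefficient
  have hR2 : ∫⁻ y' in Icc (0 : Fin d → ℝ) (fun _ => ℓ), ∫⁻ t in Ioc 0 ℓ, h (i.insertNth t y') =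
      ∑' n : ℕ, w n * ∑' k' : Fin d → ℕ, ‖∫ y' in Icc (0 : Fin d → ℝ) (fun _ => ℓ),
        ((∏ j, cosMode ℓ (k' j) (y' j) : ℝ) : ℂ) * G n y'‖ₑ ^ 2 := by
    simp_rw [← hfib]
    rw [lintegral_tsum fun n => ?_]
    · congr 1; funext n
      rw [lintegral_const_mul _ ((hGc n).measurable.enorm.pow_const 2), hA (hGc n)]
    · exact (((hGc n).measurable.enorm.pow_const 2).const_mul _).aemeasurable
  -- the left-hand side, re-indexed by `k = insertNth i n k'`
  have hL : ∑' k : Fin (d + 1) → ℕ, w (k i) * ‖∫ y in Icc (0 : Fin (d + 1) → ℝ) (fun _ => ℓ),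
        ((∏ j, cosMode ℓ (k j) (y j) : ℝ) : ℂ) * g y‖ₑ ^ 2 =
      ∑' n : ℕ, w n * ∑' k' : Fin d → ℕ, ‖∫ y' in Icc (0 : Fin d → ℝ) (fun _ => ℓ),
        ((∏ j, cosMode ℓ (k' j) (y' j) : ℝ) : ℂ) * G n y'‖ₑ ^ 2 := by
    rw [← (Fin.insertNthEquiv (fun _ => ℕ) i).tsum_eq]
    simp only [Fin.insertNthEquiv_apply, Fin.insertNth_apply_same]
    rw [ENNReal.tsum_prod']
    congr 1; funext n
    rw [← ENNReal.tsum_mul_left]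
    congr 1; funext k'
    rw [integral_Icc_prodMode_insertNth_mul hℓ i hg n k']
  rw [hL, hR, hR2]

/-! ### Parseval on the cube `[0,ℓ]^d` (induction on `d`) -/

/-- Dimension zero: the cube `[0,ℓ]^0` is a point of mass one and `u_∅ = 1`. [folklore] -/
theorem tsum_enorm_sq_coef_zero (ℓ : ℝ) (g : (Fin 0 → ℝ) → ℂ) :
    ∑' k : Fin 0 → ℕ, ‖∫ y in Icc (0 : Fin 0 → ℝ) (fun _ => ℓ),
        ((∏ j, cosMode ℓ (k j) (y j) : ℝ) : ℂ) * g y‖ₑ ^ 2 =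
      ∫⁻ y in Icc (0 : Fin 0 → ℝ) (fun _ => ℓ), ‖g y‖ₑ ^ 2 := by
  have hI : (Icc (0 : Fin 0 → ℝ) fun _ => ℓ) = univ := by
    ext y
    simp only [Set.mem_Icc, Pi.le_def, IsEmpty.forall_iff, and_self, Set.mem_univ]
  have hvol : (volume : Measure (Fin 0 → ℝ)) = Measure.dirac default := by
    rw [volume_pi, Measure.pi_of_empty _ default]
  rw [hI, Measure.restrict_univ, hvol, lintegral_dirac, tsum_fintype, Fintype.sum_unique]
  simp

/-- **Parseval for the Neumann product modes on the cube `[0,ℓ]^d`** (`ℝ≥0∞` form): for `ℓ > 0`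
and continuous `g : ℝ^d → ℂ`,
`∑_{k ∈ ℕ₀^d} ‖∫_{[0,ℓ]^d} u_k g‖² = ∫_{[0,ℓ]^d} ‖g‖²`, `u_k(y) = ∏ⱼ e_{kⱼ}(yⱼ)` — the product
modes are complete in `L²([0,ℓ]^d)` (they are orthonormal by `setIntegral_cell_mode_mul_mode`).
Induction on `d` through the slicing engine with the one-dimensional cosine Parseval on each
fibre. [cite: FournaisEtAl2024, (2.20)] -/
theorem tsum_enorm_sq_coef (hℓ : 0 < ℓ) :
    ∀ (d : ℕ) {g : (Fin d → ℝ) → ℂ}, Continuous g →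
      ∑' k : Fin d → ℕ, ‖∫ y in Icc (0 : Fin d → ℝ) (fun _ => ℓ),
          ((∏ j, cosMode ℓ (k j) (y j) : ℝ) : ℂ) * g y‖ₑ ^ 2 =
        ∫⁻ y in Icc (0 : Fin d → ℝ) (fun _ => ℓ), ‖g y‖ₑ ^ 2
  | 0, g, _ => tsum_enorm_sq_coef_zero ℓ g
  | d + 1, g, hg => by
    have key := tsum_mul_enorm_sq_coef_eq_of_fibre hℓ
      (fun hg' => tsum_enorm_sq_coef hℓ d hg') 0 hg (fun _ => 1)
      (hg.measurable.enorm.pow_const 2) (fun y' => by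
        have hc : Continuous fun t : ℝ => g (Fin.insertNth 0 t y') :=
          hg.comp (Continuous.finInsertNth 0 continuous_id continuous_const)
        simpa only [one_mul] using tsum_enorm_sq_integral_cosMode_mul hℓ hc)
    simpa only [one_mul] using key

/-! ### The Neumann form on the cube is diagonal in the product modes -/

/-- Inserting `t` at the coordinate `i` is affine in `t`, with slope `e_i`. [folklore] -/
theorem insertNth_eq_add_smul (i : Fin (d + 1)) (t : ℝ) (y' : Fin d → ℝ) :
    (i.insertNth t y' : Fin (d + 1) → ℝ) =
      i.insertNth (0 : ℝ) y' + t • (Pi.single i (1 : ℝ) : Fin (d + 1) → ℝ) := by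
  ext j
  refine Fin.succAboveCases i ?_ (fun j => ?_) j
  · simp
  · simp [Fin.insertNth_apply_succAbove, Fin.succAbove_ne]

/-- The fibre of a differentiable `g` in the direction `i` has derivative `∂ᵢg = Dg · eᵢ`.
[folklore] -/
theorem hasDerivAt_comp_insertNth (i : Fin (d + 1)) {g : (Fin (d + 1) → ℝ) → ℂ}
    (hg : Differentiable ℝ g) (y' : Fin d → ℝ) (t : ℝ) :
    HasDerivAt (fun s : ℝ => g (i.insertNth s y'))
      (fderiv ℝ g (i.insertNth t y') (Pi.single i 1)) t := by
  have hpath : HasDerivAt (fun s : ℝ => (i.insertNth s y' : Fin (d + 1) → ℝ))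
      (Pi.single i (1 : ℝ)) t := by
    have h1 : HasDerivAt
        (fun s : ℝ => i.insertNth (0 : ℝ) y' + s • (Pi.single i (1 : ℝ) : Fin (d + 1) → ℝ))
        ((1 : ℝ) • (Pi.single i (1 : ℝ) : Fin (d + 1) → ℝ)) t :=
      ((hasDerivAt_id t).smul_const _).const_add _
    rw [one_smul] at h1
    exact h1.congr_of_eventuallyEq (Eventually.of_forall fun s => insertNth_eq_add_smul i s y')
  exact (hg _).hasFDerivAt.comp_hasDerivAt t hpath

/-- **The form identity in one coordinate direction**: for `g ∈ C¹(ℝ^{d+1})`, `ℓ > 0` and a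
coordinate `i`, `∑_k (kᵢπ/ℓ)² ‖∫_{[0,ℓ]^{d+1}} u_k g‖² = ∫_{[0,ℓ]^{d+1}} ‖∂ᵢ g‖²` — the slicing
engine with the one-dimensional identity `∑ₙ (nπ/ℓ)²‖∫₀^ℓ e_n f‖² = ∫₀^ℓ‖f'‖²` (no boundary
condition) on each fibre. [cite: LSSY2005, Ch. 2, after (2.50)] -/
theorem tsum_waveNumber_sq_mul_enorm_sq_coef (hℓ : 0 < ℓ) (i : Fin (d + 1))
    {g : (Fin (d + 1) → ℝ) → ℂ} (hg : ContDiff ℝ 1 g) :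
    ∑' k : Fin (d + 1) → ℕ, ENNReal.ofReal (waveNumber ℓ (k i) ^ 2) *
        ‖∫ y in Icc (0 : Fin (d + 1) → ℝ) (fun _ => ℓ),
          ((∏ j, cosMode ℓ (k j) (y j) : ℝ) : ℂ) * g y‖ₑ ^ 2 =
      ∫⁻ y in Icc (0 : Fin (d + 1) → ℝ) (fun _ => ℓ), ‖fderiv ℝ g y (Pi.single i 1)‖ₑ ^ 2 := by
  have hgd : Differentiable ℝ g := hg.differentiable one_ne_zero
  have hdc : Continuous fun y => fderiv ℝ g y (Pi.single i 1) :=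
    (hg.continuous_fderiv one_ne_zero).clm_apply continuous_const
  refine tsum_mul_enorm_sq_coef_eq_of_fibre hℓ (fun hg' => tsum_enorm_sq_coef hℓ d hg') i
    hg.continuous (fun n => ENNReal.ofReal (waveNumber ℓ n ^ 2))
    (hdc.measurable.enorm.pow_const 2) fun y' => ?_
  have hc : Continuous fun t : ℝ => fderiv ℝ g (i.insertNth t y') (Pi.single i 1) :=
    hdc.comp (Continuous.finInsertNth i continuous_id continuous_const)
  exact tsum_waveNumber_sq_mul_enorm_sq_integral_cosMode_mul hℓ
    (fun t _ => hasDerivAt_comp_insertNth i hgd y' t) hc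

/-- **The Neumann form `∫|∇g|²` on the cube is diagonal in the product modes, with eigenvalues
`(π/ℓ)²|k|²** (`ℝ≥0∞` form): for `g ∈ C¹(ℝ^{d+1})` and `ℓ > 0`,
`∑_k (∑ᵢ (kᵢπ/ℓ)²) ‖∫_{[0,ℓ]^{d+1}} u_k g‖² = ∫_{[0,ℓ]^{d+1}} ∑ᵢ ‖∂ᵢg‖²` — no boundary condition
on `g`: `-Δ` with Neumann conditions on `[0,ℓ]^{d+1}` has form-spectrum `{(π/ℓ)²|k|²}` with
eigenbasis `(u_k)`. [cite: FournaisEtAl2024, (2.20)–(2.21)] -/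
theorem tsum_sum_waveNumber_sq_mul_enorm_sq_coef (hℓ : 0 < ℓ) {g : (Fin (d + 1) → ℝ) → ℂ}
    (hg : ContDiff ℝ 1 g) :
    ∑' k : Fin (d + 1) → ℕ, ENNReal.ofReal (∑ i, waveNumber ℓ (k i) ^ 2) *
        ‖∫ y in Icc (0 : Fin (d + 1) → ℝ) (fun _ => ℓ),
          ((∏ j, cosMode ℓ (k j) (y j) : ℝ) : ℂ) * g y‖ₑ ^ 2 =
      ∫⁻ y in Icc (0 : Fin (d + 1) → ℝ) (fun _ => ℓ),
        ∑ i, ‖fderiv ℝ g y (Pi.single i 1)‖ₑ ^ 2 := by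
  have hdc : ∀ i : Fin (d + 1), Continuous fun y => fderiv ℝ g y (Pi.single i 1) := fun i =>
    (hg.continuous_fderiv one_ne_zero).clm_apply continuous_const
  rw [lintegral_finsetSum _ fun i _ => (hdc i).measurable.enorm.pow_const 2]
  simp_rw [ENNReal.ofReal_sum_of_nonneg (fun i _ => sq_nonneg _), Finset.sum_mul]
  rw [Summable.tsum_finsetSum fun i _ => ENNReal.summable]
  exact Finset.sum_congr rfl fun i _ => tsum_waveNumber_sq_mul_enorm_sq_coef hℓ i hg

/-! ### The sharp Neumann gap of the cube -/

/-- For a non-zero multi-index, `(ℓ/π)² ∑ᵢ (kᵢπ/ℓ)² ≥ 1`. [folklore] -/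
theorem one_le_mul_sum_waveNumber_sq (hℓ : 0 < ℓ) {k : Fin (d + 1) → ℕ} (hk : k ≠ 0) :
    1 ≤ (ℓ / π) ^ 2 * ∑ i, waveNumber ℓ (k i) ^ 2 := by
  obtain ⟨i, hi⟩ : ∃ i, k i ≠ 0 := Function.ne_iff.1 hk
  have hki : (1 : ℝ) ≤ k i := by exact_mod_cast Nat.one_le_iff_ne_zero.2 hi
  have hwi : (π / ℓ) ^ 2 ≤ waveNumber ℓ (k i) ^ 2 := by
    have : π / ℓ ≤ waveNumber ℓ (k i) := by
      unfold waveNumber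
      rw [div_le_div_iff_of_pos_right hℓ]
      nlinarith [Real.pi_pos]
    exact pow_le_pow_left₀ (by positivity) this 2
  have hsum : waveNumber ℓ (k i) ^ 2 ≤ ∑ j, waveNumber ℓ (k j) ^ 2 :=
    Finset.single_le_sum (f := fun j => waveNumber ℓ (k j) ^ 2) (fun j _ => sq_nonneg _)
      (Finset.mem_univ i)
  calc (1 : ℝ) = (ℓ / π) ^ 2 * (π / ℓ) ^ 2 := by field_simp
    _ ≤ (ℓ / π) ^ 2 * ∑ j, waveNumber ℓ (k j) ^ 2 := by gcongr; exact hwi.trans hsum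

/-- **The sharp Neumann spectral gap of the cube `[0,ℓ]^{d+1}` is `π²/ℓ²`** (`ℝ≥0∞` form): for
`g ∈ C¹` and `ℓ > 0`,
`∫_{[0,ℓ]^{d+1}} |g|² ≤ |⟨u_0, g⟩|² + (ℓ/π)² ∫_{[0,ℓ]^{d+1}} |∇g|²`, `u_0 = ℓ^{-(d+1)/2}` — i.e.
`‖g - ⟨g⟩‖² = ‖Qg‖² ≤ (ℓ²/π²)⟨g, -Δ_N g⟩`: Parseval, the form identity, and `|k|² ≥ 1` for
`k ≠ 0` ("the kinetic energy of a single particle in the first excited state in the box",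
`π²/ℓ²` with Neumann conditions). [cite: LSSY2005, Ch. 2, after (2.50)] -/
theorem lintegral_enorm_sq_le_of_contDiff (hℓ : 0 < ℓ) {g : (Fin (d + 1) → ℝ) → ℂ}
    (hg : ContDiff ℝ 1 g) :
    ∫⁻ y in Icc (0 : Fin (d + 1) → ℝ) (fun _ => ℓ), ‖g y‖ₑ ^ 2 ≤
      ‖∫ y in Icc (0 : Fin (d + 1) → ℝ) (fun _ => ℓ),
          ((∏ j : Fin (d + 1), cosMode ℓ 0 (y j) : ℝ) : ℂ) * g y‖ₑ ^ 2 +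
        ENNReal.ofReal ((ℓ / π) ^ 2) * ∫⁻ y in Icc (0 : Fin (d + 1) → ℝ) (fun _ => ℓ),
          ∑ i, ‖fderiv ℝ g y (Pi.single i 1)‖ₑ ^ 2 := by
  rw [← tsum_enorm_sq_coef hℓ (d + 1) hg.continuous,
    ← tsum_sum_waveNumber_sq_mul_enorm_sq_coef hℓ hg, ← ENNReal.tsum_mul_left,
    ENNReal.tsum_eq_add_tsum_ite (0 : Fin (d + 1) → ℕ)]
  refine add_le_add (le_of_eq (by simp only [Pi.zero_apply])) (ENNReal.tsum_le_tsum fun k => ?_)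
  split_ifs with hk
  · exact zero_le
  · rw [← mul_assoc, ← ENNReal.ofReal_mul (sq_nonneg _)]
    have h1 : (1 : ℝ≥0∞) ≤ ENNReal.ofReal ((ℓ / π) ^ 2 * ∑ i, waveNumber ℓ (k i) ^ 2) := by
      rw [← ENNReal.ofReal_one]
      exact ENNReal.ofReal_le_ofReal (one_le_mul_sum_waveNumber_sq hℓ hk)
    exact le_mul_of_one_le_left (zero_le) h1

/-! ### Real-valued forms -/

/-- From an `ℝ≥0∞` identity `∑ᵢ ofReal(aᵢ) = ofReal(S)` with `aᵢ, S ≥ 0` to a real `HasSum`.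
[folklore] -/
theorem hasSum_of_tsum_ofReal_eq {ι : Type*} {a : ι → ℝ} (ha : ∀ i, 0 ≤ a i) {S : ℝ}
    (hS : 0 ≤ S) (h : ∑' i, ENNReal.ofReal (a i) = ENNReal.ofReal S) : HasSum a S := by
  have htop : ∑' i, ENNReal.ofReal (a i) ≠ ⊤ := h ▸ ENNReal.ofReal_ne_top
  have hs : Summable fun i => (ENNReal.ofReal (a i)).toReal := ENNReal.summable_toReal htop
  simp_rw [ENNReal.toReal_ofReal (ha _)] at hs
  have htsum : ∑' i, a i = S := by
    have := congrArg ENNReal.toReal h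
    rw [ENNReal.tsum_toReal_eq (fun _ => ENNReal.ofReal_ne_top), ENNReal.toReal_ofReal hS] at this
    simp_rw [ENNReal.toReal_ofReal (ha _)] at this
    exact this
  exact htsum ▸ hs.hasSum

/-- **Parseval on the cube, real form**: for continuous `g : ℝ^d → ℂ` and `ℓ > 0`,
`∑_k ‖∫_{[0,ℓ]^d} u_k g‖² = ∫_{[0,ℓ]^d} ‖g‖²`. [cite: FournaisEtAl2024, (2.20)] -/
theorem hasSum_sq_norm_coef (hℓ : 0 < ℓ) {g : (Fin d → ℝ) → ℂ} (hg : Continuous g) :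
    HasSum (fun k : Fin d → ℕ => ‖∫ y in Icc (0 : Fin d → ℝ) (fun _ => ℓ),
        ((∏ j, cosMode ℓ (k j) (y j) : ℝ) : ℂ) * g y‖ ^ 2)
      (∫ y in Icc (0 : Fin d → ℝ) (fun _ => ℓ), ‖g y‖ ^ 2) := by
  refine hasSum_of_tsum_ofReal_eq (fun _ => sq_nonneg _) (integral_nonneg fun _ => sq_nonneg _) ?_
  simp_rw [ENNReal.ofReal_pow (norm_nonneg _), ofReal_norm]
  rw [tsum_enorm_sq_coef hℓ d hg,
    ofReal_integral_eq_lintegral_ofReal ?_ (ae_of_all _ fun _ => sq_nonneg _)]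
  · simp_rw [ENNReal.ofReal_pow (norm_nonneg _), ofReal_norm]
  · exact (hg.norm.pow 2).continuousOn.integrableOn_compact isCompact_Icc

/-- **The form identity on the cube, real form**: for `g ∈ C¹(ℝ^{d+1})` and `ℓ > 0`,
`∑_k (∑ᵢ(kᵢπ/ℓ)²) ‖∫ u_k g‖² = ∫_{[0,ℓ]^{d+1}} ∑ᵢ ‖∂ᵢ g‖²`. [cite: FournaisEtAl2024, (2.20)–(2.21)] -/
theorem hasSum_sum_waveNumber_sq_mul_sq_norm_coef (hℓ : 0 < ℓ) {g : (Fin (d + 1) → ℝ) → ℂ}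
    (hg : ContDiff ℝ 1 g) :
    HasSum (fun k : Fin (d + 1) → ℕ => (∑ i, waveNumber ℓ (k i) ^ 2) *
        ‖∫ y in Icc (0 : Fin (d + 1) → ℝ) (fun _ => ℓ),
          ((∏ j, cosMode ℓ (k j) (y j) : ℝ) : ℂ) * g y‖ ^ 2)
      (∫ y in Icc (0 : Fin (d + 1) → ℝ) (fun _ => ℓ), ∑ i, ‖fderiv ℝ g y (Pi.single i 1)‖ ^ 2) := by
  have hdc : ∀ i : Fin (d + 1), Continuous fun y => fderiv ℝ g y (Pi.single i 1) := fun i =>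
    (hg.continuous_fderiv one_ne_zero).clm_apply continuous_const
  refine hasSum_of_tsum_ofReal_eq (fun _ => by positivity)
    (integral_nonneg fun _ => by positivity) ?_
  have hterm : ∀ k : Fin (d + 1) → ℕ, ENNReal.ofReal ((∑ i, waveNumber ℓ (k i) ^ 2) *
      ‖∫ y in Icc (0 : Fin (d + 1) → ℝ) (fun _ => ℓ),
          ((∏ j, cosMode ℓ (k j) (y j) : ℝ) : ℂ) * g y‖ ^ 2) =
      ENNReal.ofReal (∑ i, waveNumber ℓ (k i) ^ 2) *
        ‖∫ y in Icc (0 : Fin (d + 1) → ℝ) (fun _ => ℓ),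
          ((∏ j, cosMode ℓ (k j) (y j) : ℝ) : ℂ) * g y‖ₑ ^ 2 := fun k => by
    rw [ENNReal.ofReal_mul (Finset.sum_nonneg fun _ _ => sq_nonneg _),
      ENNReal.ofReal_pow (norm_nonneg _), ofReal_norm]
  rw [tsum_congr hterm, tsum_sum_waveNumber_sq_mul_enorm_sq_coef hℓ hg,
    ofReal_integral_eq_lintegral_ofReal ?_ (ae_of_all _ fun _ => by positivity)]
  · congr 1; funext y
    rw [ENNReal.ofReal_sum_of_nonneg fun _ _ => sq_nonneg _]
    simp_rw [ENNReal.ofReal_pow (norm_nonneg _), ofReal_norm]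
  · exact (continuous_finsetSum _ fun i _ => (hdc i).norm.pow 2).continuousOn.integrableOn_compact
      isCompact_Icc

/-! ### On the one-particle space `Space = ℝ³` of the topic: the open box `Λ_ℓ = (0,ℓ)³` -/

section Box

open Literature.MathematicalPhysics.QuantumManyBody.BoseGas

variable {E : Type*} [NormedAddCommGroup E] [NormedSpace ℝ E]

/-- The open box is the preimage of the open coordinate cube under `ofLp`. [folklore] -/
theorem box_eq_preimage_toLp_symm (ℓ : ℝ) :
    box ℓ = (MeasurableEquiv.toLp 2 (Fin 3 → ℝ)).symm ⁻¹' (Set.pi univ fun _ => Ioo (0 : ℝ) ℓ) := by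
  ext x; simp [box, MeasurableEquiv.coe_toLp_symm]

/-- The open coordinate cube is a.e. the closed cube. [folklore] -/
theorem univ_pi_Ioo_ae_eq_Icc_fin3 (ℓ : ℝ) :
    (Set.pi univ fun _ : Fin 3 => Ioo (0 : ℝ) ℓ) =ᵐ[volume] Icc (0 : Fin 3 → ℝ) fun _ => ℓ := by
  rw [volume_pi]; exact Measure.univ_pi_Ioo_ae_eq_Icc

/-- **Set integrals over the box in coordinates**: `∫_{Λ_ℓ} F = ∫_{[0,ℓ]³} F ∘ toLp`
(the identification `ℝ³ ≃ (Fin 3 → ℝ)` preserves Lebesgue measure). [folklore] -/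
theorem setIntegral_box_eq_integral_Icc (ℓ : ℝ) (F : Space → E) :
    ∫ x in box ℓ, F x = ∫ y in Icc (0 : Fin 3 → ℝ) (fun _ => ℓ), F (WithLp.toLp 2 y) := by
  have hmp : MeasurePreserving (MeasurableEquiv.toLp 2 (Fin 3 → ℝ)).symm volume volume :=
    EuclideanSpace.volume_preserving_symm_measurableEquiv_toLp (Fin 3)
  have h1 : (fun x : Space => F x) = fun x =>
      (fun y : Fin 3 → ℝ => F (WithLp.toLp 2 y)) ((MeasurableEquiv.toLp 2 (Fin 3 → ℝ)).symm x) := by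
    funext x; simp
  rw [h1, box_eq_preimage_toLp_symm,
    hmp.setIntegral_preimage_emb (MeasurableEquiv.measurableEmbedding _)
      (fun y : Fin 3 → ℝ => F (WithLp.toLp 2 y)) _,
    setIntegral_congr_set (univ_pi_Ioo_ae_eq_Icc_fin3 ℓ)]

/-- **Lower Lebesgue integrals over the box in coordinates.** [folklore] -/
theorem setLIntegral_box_eq_lintegral_Icc (ℓ : ℝ) (F : Space → ℝ≥0∞) :
    ∫⁻ x in box ℓ, F x = ∫⁻ y in Icc (0 : Fin 3 → ℝ) (fun _ => ℓ), F (WithLp.toLp 2 y) := by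
  have hmp : MeasurePreserving (MeasurableEquiv.toLp 2 (Fin 3 → ℝ)).symm volume volume :=
    EuclideanSpace.volume_preserving_symm_measurableEquiv_toLp (Fin 3)
  have h1 : (fun x : Space => F x) = fun x =>
      (fun y : Fin 3 → ℝ => F (WithLp.toLp 2 y)) ((MeasurableEquiv.toLp 2 (Fin 3 → ℝ)).symm x) := by
    funext x; simp
  rw [h1, box_eq_preimage_toLp_symm,
    hmp.setLIntegral_comp_preimage_emb (MeasurableEquiv.measurableEmbedding _)
      (fun y : Fin 3 → ℝ => F (WithLp.toLp 2 y)) _,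
    setLIntegral_congr (univ_pi_Ioo_ae_eq_Icc_fin3 ℓ)]

/-- The product modes in coordinates. [cite: FournaisEtAl2024, (2.20)] -/
theorem mode_toLp (ℓ : ℝ) (k : Fin 3 → ℕ) (y : Fin 3 → ℝ) :
    mode ℓ k (WithLp.toLp 2 y) = ∏ j, cosMode ℓ (k j) (y j) := by
  simp [mode]

/-- Partial derivatives in coordinates: `∂ᵢ(f ∘ toLp)(y) = ∂ᵢ f(toLp y)`, the latter along
`EuclideanSpace.single i 1` as in `kineticDensity`. [folklore] -/
theorem fderiv_comp_toLp_single {f : Space → E} (y : Fin 3 → ℝ) (i : Fin 3) :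
    fderiv ℝ (fun y : Fin 3 → ℝ => f (WithLp.toLp 2 y)) y (Pi.single i 1) =
      fderiv ℝ f (WithLp.toLp 2 y) (EuclideanSpace.single i 1) := by
  have : (fun y : Fin 3 → ℝ => f (WithLp.toLp 2 y)) =
      f ∘ ⇑(PiLp.continuousLinearEquiv 2 ℝ (fun _ : Fin 3 => ℝ)).symm := rfl
  rw [this, ContinuousLinearEquiv.comp_right_fderiv, ContinuousLinearMap.comp_apply]
  simp [PiLp.toLp_single, EuclideanSpace.single]

/-- **Parseval for the Neumann eigenbasis of the box `Λ_ℓ = (0,ℓ)³`** (`ℝ≥0∞` form): for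
continuous `f : ℝ³ → ℂ` and `ℓ > 0`, `∑_{k ∈ ℕ₀³} |⟨u_k, f⟩_{L²(Λ)}|² = ‖f‖²_{L²(Λ)}` — the
`u_k` of `mode` form an orthonormal BASIS of `L²(Λ)`. [cite: FournaisEtAl2024, (2.20)] -/
theorem tsum_enorm_sq_setIntegral_box_mode_mul (hℓ : 0 < ℓ) {f : Space → ℂ}
    (hf : Continuous f) :
    ∑' k : Fin 3 → ℕ, ‖∫ x in box ℓ, (mode ℓ k x : ℂ) * f x‖ₑ ^ 2 = ∫⁻ x in box ℓ, ‖f x‖ₑ ^ 2 := by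
  simp_rw [setIntegral_box_eq_integral_Icc ℓ, setLIntegral_box_eq_lintegral_Icc ℓ, mode_toLp]
  exact tsum_enorm_sq_coef hℓ 3 (hf.comp (PiLp.continuous_toLp 2 _))

/-- **Parseval for the Neumann eigenbasis of the box**, real form: for continuous `f : ℝ³ → ℂ`,
`HasSum (k ↦ |⟨u_k, f⟩|²) ‖f‖²_{L²(Λ_ℓ)}`. [cite: FournaisEtAl2024, (2.20)] -/
theorem hasSum_sq_norm_setIntegral_box_mode_mul (hℓ : 0 < ℓ) {f : Space → ℂ}
    (hf : Continuous f) :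
    HasSum (fun k : Fin 3 → ℕ => ‖∫ x in box ℓ, (mode ℓ k x : ℂ) * f x‖ ^ 2)
      (∫ x in box ℓ, ‖f x‖ ^ 2) := by
  simp_rw [setIntegral_box_eq_integral_Icc ℓ, mode_toLp]
  exact hasSum_sq_norm_coef hℓ (hf.comp (PiLp.continuous_toLp 2 _))

/-- **The Neumann kinetic energy on the box is diagonal in the eigenbasis `u_k`, with
eigenvalues `(π/ℓ)²|k|²`** (`ℝ≥0∞` form): for `f ∈ C¹(ℝ³)` and `ℓ > 0`,
`∑_k (π/ℓ)²|k|² |⟨u_k, f⟩|² = ∫_{Λ_ℓ} ∑ᵢ |∂ᵢ f|²` (no boundary condition on `f`: the Neumann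
form), `-Δu_k = (π/ℓ)²|k|²u_k`. [cite: FournaisEtAl2024, (2.20)–(2.21)] -/
theorem tsum_sum_waveNumber_sq_mul_enorm_sq_setIntegral_box_mode_mul (hℓ : 0 < ℓ)
    {f : Space → ℂ} (hf : ContDiff ℝ 1 f) :
    ∑' k : Fin 3 → ℕ, ENNReal.ofReal (∑ i, waveNumber ℓ (k i) ^ 2) *
        ‖∫ x in box ℓ, (mode ℓ k x : ℂ) * f x‖ₑ ^ 2 =
      ∫⁻ x in box ℓ, ∑ i, ‖fderiv ℝ f x (EuclideanSpace.single i 1)‖ₑ ^ 2 := by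
  simp_rw [setIntegral_box_eq_integral_Icc ℓ, setLIntegral_box_eq_lintegral_Icc ℓ, mode_toLp,
    ← fderiv_comp_toLp_single]
  exact tsum_sum_waveNumber_sq_mul_enorm_sq_coef hℓ (hf.comp PiLp.contDiff_toLp)

/-- **The sharp Neumann gap `π²/ℓ²` of the box `Λ_ℓ = (0,ℓ)³`** (`ℝ≥0∞` form): for `f ∈ C¹(ℝ³)`
and `ℓ > 0`, `‖f‖²_{L²(Λ)} ≤ |⟨u_0, f⟩|² + (ℓ/π)² ∫_Λ |∇f|²` with `u_0 = ℓ^{-3/2}` the condensate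
mode, i.e. `⟨f, Qf⟩ ≤ (ℓ²/π²)⟨f, -Δ_N f⟩` for `Q = 1 - |u_0⟩⟨u_0|`. [cite: LSSY2005, Ch. 2, after (2.50)] -/
theorem setLIntegral_box_enorm_sq_le (hℓ : 0 < ℓ) {f : Space → ℂ} (hf : ContDiff ℝ 1 f) :
    ∫⁻ x in box ℓ, ‖f x‖ₑ ^ 2 ≤
      ‖∫ x in box ℓ, (mode ℓ 0 x : ℂ) * f x‖ₑ ^ 2 +
        ENNReal.ofReal ((ℓ / π) ^ 2) *
          ∫⁻ x in box ℓ, ∑ i, ‖fderiv ℝ f x (EuclideanSpace.single i 1)‖ₑ ^ 2 := by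
  rw [setIntegral_box_eq_integral_Icc ℓ, setLIntegral_box_eq_lintegral_Icc ℓ,
    setLIntegral_box_eq_lintegral_Icc ℓ]
  simp_rw [mode_toLp, Pi.zero_apply, ← fderiv_comp_toLp_single]
  exact lintegral_enorm_sq_le_of_contDiff hℓ (hf.comp PiLp.contDiff_toLp)

end Box

end Literature.MathematicalPhysics.QuantumManyBody.NeumannBox

end
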